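import Mathlib.FieldTheory.IsAlgClosed.Basic
import Literature.NumberTheory.DiophantineGeometry.FunctionFieldGenusRiemannTheoremProofs
import Literature.NumberTheory.DiophantineGeometry.FunctionFieldGenusInfinitePlacesProofs
import Literature.AnabelianGeometry.AbsoluteAnabelian.AbsTopIII.LinearSystems
import HarnessLib

/-!
# [AbsTopIII] Prop. 1.3 — proofs, part 1: constants and evaluation at points

Mochizuki, *Topics in Absolute Anabelian Geometry III*, §1, Proposition 1.3 (Additive Structure
via Valuation and Evaluation Maps), manuscript pp. 30–31 (lit key `paper:url-5493eb38cbb7`).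
This is the first of the PROOF-ONLY companion files of `AbsTopIII/LinearSystems.lean` (typed by
seat abc-iut-L4-t1; statement `Prop_1_3` unchanged and not restated here) discharging the named
fact `Prop_1_3` in the kernel.  Everything here concerns ONE algebraic function field of one
variable `K/k` over an algebraically closed field `k` (the function field of a proper curve):

* the printed first step "`k^× ⊆ K_X^×` may be constructed as the intersection `⋂_v Ker(v)`"
  (`exists_algebraMap_eq_of_forall_ord_nonneg`, `exists_constUnits_eq_iff_forall_ord_eq_zero`),
  from `L(0) = k` (tree: `riemannRochSpace_zero_eq_bot`, Stichtenoth Lemma 1.4.7 (a)) — for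
  which we record that an algebraically closed `k` is integrally closed in `K`;
* the printed second step "`Ker(v) = U_v × k^×` [...] allows us to evaluate elements of `Ker(v)`"
  (`exists_hasValue`, `HasValue.unique`, `hasValue_iff_mul_inv_mem_unitsWithValueOne`): every
  place is rational because its residue field is finite over the algebraically closed `k`
  (tree: `finiteDimensional_residueField_holds`, Stichtenoth Prop. 1.1.15);
* the arithmetic of values (`HasValue.add`, `HasValue.sub`, `HasValue.ord_eq_zero`, …).

The replacement for the linear systems of Prop. 1.2 (a function with only simple poles and the
characterisation of `λ + s`) is in `LinearSystemsWitnessProofs`; the transport along an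
isomorphism of triples and the theorem `Prop_1_3_holds` are in `LinearSystemsTransportProofs`,
`LinearSystemsProofs`.  No new definitions are introduced (proof-only companion).
-/

noncomputable section

open scoped Classical

namespace Literature.AnabelianGeometry.AbsoluteAnabelian.AbsTopIII

open Literature.NumberTheory.DiophantineGeometry
open Literature.NumberTheory.DiophantineGeometry.AlgFunctionField

universe u v

variable {k : Type u} {K : Type v} [Field k] [Field K] [Algebra k K]

/-! ### Constants -/

/-- An algebraically closed field `k` is integrally closed in any field extension `K`: an element
of `K` integral over `k` has a linear minimal polynomial (`IsAlgClosed.degree_eq_one_of_irreducible`),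
hence lies in `k`.  This supplies the tree's full-constant-field hypothesis
`[IsIntegrallyClosedIn k K]` in the setting "`k` algebraically closed" of [AbsTopIII] Prop. 1.1.
[cite: MochizukiAbsTopIII2015, Prop 1.1 p.29] -/
theorem isIntegrallyClosedIn_of_isAlgClosed [IsAlgClosed k] : IsIntegrallyClosedIn k K := by
  refine (isIntegrallyClosedIn_iff (R := k) (A := K)).2 ⟨(algebraMap k K).injective, ?_⟩
  intro x hx
  have h1 : (minpoly k x).degree = 1 :=
    IsAlgClosed.degree_eq_one_of_irreducible k (minpoly.irreducible hx)
  obtain ⟨y, hy⟩ := minpoly.mem_range_of_degree_eq_one k x h1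
  exact ⟨y, hy⟩

/-- A nonzero constant has valuation `1` at every place (Stichtenoth 1.1.5 (c): `ord_v λ = 0`).
[cite: MochizukiAbsTopIII2015, Prop 1.3 p.30] -/
theorem valuation_algebraMap_eq_one_of_ne_zero (v : PlaceOver k K) {a : k} (ha : a ≠ 0) :
    v.valuation (algebraMap k K a) = 1 := by
  have h0 : algebraMap k K a ≠ 0 := (map_ne_zero _).2 ha
  have h := (v.valuation_eq_zpow_iff_ord_eq h0 0).2 (PlaceOver.ord_algebraMap_holds v ha)
  rwa [zpow_zero] at h

/-- "`k^× ⊆ K_X^×` may be constructed as the intersection `⋂_{v ∈ V_X} Ker(v)`" (p. 30), the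
nontrivial inclusion in a sharper form: a nonzero function without poles (`ord_v f ≥ 0` for all
`v`) is a nonzero constant — because `L(0) = k` for the full constant field `k` (tree:
`riemannRochSpace_zero_eq_bot`). [cite: MochizukiAbsTopIII2015, Prop 1.3 p.30] -/
theorem exists_algebraMap_eq_of_forall_ord_nonneg [IsAlgClosed k] [IsAlgFunctionField k K]
    {f : K} (hf : f ≠ 0) (h : ∀ v : PlaceOver k K, 0 ≤ v.ord f) :
    ∃ c : k, c ≠ 0 ∧ algebraMap k K c = f := by
  haveI := isIntegrallyClosedIn_of_isAlgClosed (k := k) (K := K)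
  have hmem : f ∈ riemannRochSpace (0 : Divisor k K) := by
    rw [mem_riemannRochSpace_zero_iff]
    intro v
    exact (v.mem_toValuationSubring_iff_ord_nonneg hf).2 (h v)
  rw [riemannRochSpace_zero_eq_bot, Subalgebra.mem_toSubmodule, Algebra.mem_bot] at hmem
  obtain ⟨c, hc⟩ := hmem
  refine ⟨c, ?_, hc⟩
  rintro rfl
  rw [map_zero] at hc
  exact hf hc.symm

/-- "`k^× = ⋂_{v ∈ V_X} Ker(v)`" (p. 30): a unit `f ∈ K^×` is a constant iff `ord_v f = 0` for
every place `v`. [cite: MochizukiAbsTopIII2015, Prop 1.3 p.30] -/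
theorem exists_constUnits_eq_iff_forall_ord_eq_zero [IsAlgClosed k] [IsAlgFunctionField k K]
    (f : Kˣ) : (∃ c : kˣ, constUnits k K c = f) ↔ ∀ v : PlaceOver k K, v.ord (f : K) = 0 := by
  constructor
  · rintro ⟨c, rfl⟩ v
    exact PlaceOver.ord_algebraMap_holds v c.ne_zero
  · intro h
    obtain ⟨c, hc0, hc⟩ :=
      exists_algebraMap_eq_of_forall_ord_nonneg f.ne_zero (fun v => (h v).ge)
    exact ⟨Units.mk0 c hc0, Units.ext (by simpa [constUnits] using hc)⟩

/-- A nonconstant function has a pole: if `ord_w f ≠ 0` for some place `w` then `ord_v f < 0`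
for some place `v` (else `f` would be a regular function, i.e. a constant).
[cite: MochizukiAbsTopIII2015, Prop 1.3 p.30] -/
theorem exists_ord_neg [IsAlgClosed k] [IsAlgFunctionField k K] {f : K} (hf : f ≠ 0)
    {w : PlaceOver k K} (hw : w.ord f ≠ 0) : ∃ v : PlaceOver k K, v.ord f < 0 := by
  by_contra! hnn
  obtain ⟨c, hc0, rfl⟩ := exists_algebraMap_eq_of_forall_ord_nonneg hf hnn
  exact hw (PlaceOver.ord_algebraMap_holds w hc0)

/-- A nonconstant function has a zero: if `ord_w f ≠ 0` for some place `w` then `0 < ord_v f`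
for some place `v` (apply `exists_ord_neg` to `f⁻¹`). [cite: MochizukiAbsTopIII2015, Prop 1.3 p.30] -/
theorem exists_ord_pos [IsAlgClosed k] [IsAlgFunctionField k K] {f : K} (hf : f ≠ 0)
    {w : PlaceOver k K} (hw : w.ord f ≠ 0) : ∃ v : PlaceOver k K, 0 < v.ord f := by
  have hw' : w.ord f⁻¹ ≠ 0 := by
    rw [w.ord_inv hf]
    exact neg_ne_zero.2 hw
  obtain ⟨v, hv⟩ := exists_ord_neg (inv_ne_zero hf) hw'
  refine ⟨v, ?_⟩
  rw [v.ord_inv hf] at hv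
  omega

/-! ### Evaluation at a point: `Ker(v) = U_v × k^×` -/

/-- An element of valuation `< 1` lies in the valuation ring (`𝔪_v ⊆ 𝒪_v`; Stichtenoth
Thm. 1.1.13 (a)). [cite: Stichtenoth2009, Thm. 1.1.13(a)] -/
theorem mem_toValuationSubring_of_valuation_lt_one (v : PlaceOver k K) {x : K}
    (h : v.valuation x < 1) : x ∈ v.toValuationSubring :=
  (v.toValuationSubring.valuation_le_one_iff x).1 h.le

/-- A constant `λ` takes the value `λ` everywhere. [cite: MochizukiAbsTopIII2015, Prop 1.2 (ii) p.29] -/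
theorem hasValue_algebraMap (v : PlaceOver k K) (a : k) : HasValue v (algebraMap k K a) a := by
  unfold HasValue
  rw [sub_self, Valuation.map_zero]
  exact zero_lt_one

namespace HasValue

/-- A function with a value at `v` is regular at `v` (`f ∈ 𝒪_v`). [cite: MochizukiAbsTopIII2015, Prop 1.2 (ii) p.29] -/
theorem mem_toValuationSubring {v : PlaceOver k K} {f : K} {a : k} (h : HasValue v f a) :
    f ∈ v.toValuationSubring := by
  have h1 : f = (f - algebraMap k K a) + algebraMap k K a := by ring
  rw [h1]
  exact add_mem (mem_toValuationSubring_of_valuation_lt_one v h) (v.algebraMap_mem a)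

/-- The value of a function at a point is unique ("`k` is algebraically closed", so `𝒪_v/𝔪_v = k`;
here: two constants congruent mod `𝔪_v` are equal). [cite: MochizukiAbsTopIII2015, Prop 1.2 (ii) p.29] -/
theorem unique {v : PlaceOver k K} {f : K} {a b : k} (ha : HasValue v f a) (hb : HasValue v f b) :
    a = b := by
  by_contra hab
  have hne : a - b ≠ 0 := sub_ne_zero.2 hab
  have h1 : v.valuation (algebraMap k K (a - b)) = 1 :=
    valuation_algebraMap_eq_one_of_ne_zero v hne
  have h2 : algebraMap k K (a - b) = (f - algebraMap k K b) - (f - algebraMap k K a) := by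
    rw [map_sub]; ring
  have h3 : v.valuation (algebraMap k K (a - b)) < 1 := by
    rw [h2]
    exact Valuation.map_sub_lt _ hb ha
  exact absurd h1 h3.ne

/-- Values add: `(f + g)(x) = f(x) + g(x)`. [cite: MochizukiAbsTopIII2015, Prop 1.2 (iii) p.30] -/
theorem add {v : PlaceOver k K} {f g : K} {a b : k} (hf : HasValue v f a) (hg : HasValue v g b) :
    HasValue v (f + g) (a + b) := by
  unfold HasValue at hf hg ⊢
  have h1 : f + g - algebraMap k K (a + b) = (f - algebraMap k K a) + (g - algebraMap k K b) := by
    rw [map_add]; ring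
  rw [h1]
  exact Valuation.map_add_lt _ hf hg

/-- Values subtract: `(f - g)(x) = f(x) - g(x)`. [cite: MochizukiAbsTopIII2015, Prop 1.2 (iii) p.30] -/
theorem sub {v : PlaceOver k K} {f g : K} {a b : k} (hf : HasValue v f a) (hg : HasValue v g b) :
    HasValue v (f - g) (a - b) := by
  unfold HasValue at hf hg ⊢
  have h1 : f - g - algebraMap k K (a - b) = (f - algebraMap k K a) - (g - algebraMap k K b) := by
    rw [map_sub]; ring
  rw [h1]
  exact Valuation.map_sub_lt _ hf hg

/-- A function with a NONZERO value at `v` is a unit at `v`: `ord_v f = 0`.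
[cite: MochizukiAbsTopIII2015, Prop 1.3 p.30] -/
theorem ord_eq_zero {v : PlaceOver k K} {f : K} {a : k} (h : HasValue v f a) (ha : a ≠ 0) :
    v.ord f = 0 := by
  unfold HasValue at h
  have hva : v.valuation (algebraMap k K a) = 1 := valuation_algebraMap_eq_one_of_ne_zero v ha
  have hlt : v.valuation (f - algebraMap k K a) < v.valuation (algebraMap k K a) := by
    rwa [hva]
  have hf : v.valuation f = 1 := by
    have h1 : f = algebraMap k K a + (f - algebraMap k K a) := by ring
    rw [h1, Valuation.map_add_eq_of_lt_left _ hlt, hva]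
  have hf0 : f ≠ 0 := by
    rintro rfl
    rw [Valuation.map_zero] at hf
    exact zero_ne_one hf
  exact (v.valuation_eq_zpow_iff_ord_eq hf0 0).1 (by rw [zpow_zero, hf])

/-- If `f(x) = λ` then `ord_x (f − λ) > 0` whenever `f ≠ λ`. [cite: MochizukiAbsTopIII2015, Prop 1.2 (ii) p.29] -/
theorem ord_sub_pos {v : PlaceOver k K} {f : K} {a : k} (h : HasValue v f a)
    (hne : f ≠ algebraMap k K a) : 0 < v.ord (f - algebraMap k K a) :=
  (v.valuation_lt_one_iff_ord_pos (sub_ne_zero.2 hne)).1 h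

end HasValue

/-- `f(x) = 0 ⟺ ord_x f > 0` for `f ≠ 0`. [cite: MochizukiAbsTopIII2015, Prop 1.2 (ii) p.29] -/
theorem hasValue_zero_iff_ord_pos (v : PlaceOver k K) {f : K} (hf : f ≠ 0) :
    HasValue v f 0 ↔ 0 < v.ord f := by
  unfold HasValue
  rw [map_zero, sub_zero]
  exact v.valuation_lt_one_iff_ord_pos hf

/-- "`k` is algebraically closed": every place of `K/k` is rational, i.e. every `f ∈ 𝒪_v` has a
value `f(x) ∈ k` — the residue field `𝒪_v/𝔪_v` is finite over `k` (Stichtenoth Prop. 1.1.15, tree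
`finiteDimensional_residueField_holds`), hence equal to `k`. This is the evaluation
"`Ker(v) → k^×`" of the printed proof. [cite: MochizukiAbsTopIII2015, Prop 1.3 p.30] -/
theorem exists_hasValue [IsAlgClosed k] [IsAlgFunctionField k K] (v : PlaceOver k K) {f : K}
    (hf : f ∈ v.toValuationSubring) : ∃ a : k, HasValue v f a := by
  haveI : FiniteDimensional k v.residueField :=
    AlgFunctionField.PlaceOver.finiteDimensional_residueField_holds (K := k) (F := K) v
  haveI : Algebra.IsIntegral k v.residueField := Algebra.IsIntegral.of_finite k v.residueField
  obtain ⟨a, ha⟩ := (IsAlgClosed.algebraMap_bijective_of_isIntegral (k := k)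
    (K := v.residueField)).2 (IsLocalRing.residue v.toValuationSubring ⟨f, hf⟩)
  refine ⟨a, ?_⟩
  have h1 : IsLocalRing.residue v.toValuationSubring
      (⟨f, hf⟩ - algebraMap k v.toValuationSubring a) = 0 := by
    rw [map_sub, ← PlaceOver.algebraMap_residueField_apply, ha, sub_self]
  rw [IsLocalRing.residue_eq_zero_iff, ValuationSubring.valuation_lt_one_iff] at h1
  change v.valuation (f - algebraMap k K a) < 1
  simpa using h1

/-- For a unit `f` at `v` (`ord_v f = 0`) the value `f(x)` is a NONZERO constant.
[cite: MochizukiAbsTopIII2015, Prop 1.3 p.30] -/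
theorem exists_hasValue_ne_zero [IsAlgClosed k] [IsAlgFunctionField k K] (v : PlaceOver k K)
    {f : K} (hf : f ≠ 0) (h0 : v.ord f = 0) : ∃ a : k, a ≠ 0 ∧ HasValue v f a := by
  obtain ⟨a, ha⟩ := exists_hasValue v ((v.mem_toValuationSubring_iff_ord_nonneg hf).2 h0.ge)
  refine ⟨a, ?_, ha⟩
  rintro rfl
  have := (hasValue_zero_iff_ord_pos v hf).1 ha
  omega

/-- "`Ker(v) = U_v × k^×`" (p. 30) in the form used for transport: for `f ∈ K^×` and `λ ∈ k^×`,
`f(x) = λ` iff `f · λ⁻¹ ∈ U_v`. [cite: MochizukiAbsTopIII2015, Prop 1.3 p.30] -/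
theorem hasValue_iff_mul_inv_mem_unitsWithValueOne (v : PlaceOver k K) (f : Kˣ) (c : kˣ) :
    HasValue v (f : K) c ↔ f * (constUnits k K c)⁻¹ ∈ unitsWithValueOne v := by
  rw [mem_unitsWithValueOne_iff]
  unfold HasValue
  have hc : (algebraMap k K c : K) ≠ 0 := (map_ne_zero _).2 c.ne_zero
  have hval : v.valuation (algebraMap k K c) = 1 :=
    valuation_algebraMap_eq_one_of_ne_zero v c.ne_zero
  have hcoe : ((f * (constUnits k K c)⁻¹ : Kˣ) : K) = (f : K) * (algebraMap k K c)⁻¹ := by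
    simp [constUnits]
  have key : ((f * (constUnits k K c)⁻¹ : Kˣ) : K) - algebraMap k K 1
      = ((f : K) - algebraMap k K c) * (algebraMap k K c)⁻¹ := by
    rw [hcoe, map_one, sub_mul, mul_inv_cancel₀ hc]
  rw [key, Valuation.map_mul, map_inv₀, hval, inv_one, mul_one]

end Literature.AnabelianGeometry.AbsoluteAnabelian.AbsTopIII
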